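import Mathlib
import Summits.PneNP.PneNP.Theorems.NegLimitedDoorPlantedTransfer
import Summits.PneNP.PneNP.Theorems.NegLimitedLadderNullMass
import Summits.PneNP.PneNP.Theorems.NegLimitedLadderLargeNPow
import Summits.PneNP.PneNP.Theorems.NegLimitedLadderAdvantage
import Literature.Computability.Complexity.RossmanMonotoneCliqueProofs
import HarnessLib

/-!
# Route NegLimited — ladder engine `NeglimitedCliqueFixedK` from the three supports (line `density-ladder`, stub 4; rung F-N1/p3, ROUND-9 §B)

Registered stub `stub_fixedKAssembly` of the skeleton `density-ladder`
(HOME/pnp-ideate-p3/r9/ladder/density-ladder.lean, sha 2d55ebf8) on the support item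
`NegLimited.NeglimitedLogOverOmegaNegations` (stmt-PneNP-19555): the arithmetic assembly
`LargeNPow → LadderAdvantage → SubcriticalNullMass → NeglimitedCliqueFixedK`.

For a fixed `k ≥ 5` put `δ = k⁻³`, `a = 2δ/(k-1) = 2/(k³(k-1))`, `η = m^{-a}`, `T = ⌊m^a⌋₊`,
`p⁻ = pMinus k δ m = m^{-2(1+δ)/(k-1)}`, `p_j = 1 - (1 - p⁻)^j`.  Let `D` be a De Morgan circuit computing
`CLIQUE(m,k)` with `t ≤ ⌊log₂ m⌋/k⁴` NOT gates and suppose `size D + 1 ≤ m^{k/4}`.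
* Cover (landed `NegLimitedDoor.stub_amCoverMonPairs`): `≤ 2^{t+1} - 1` members, each constant or computed
  by a `{∧₂, ∨₂}`-circuit `M` with `size M ≤ size D`; every planted pair `(x, x ∪ K_A)` with
  `CLIQUE(x) = 0` is a jump of `D` (`cliqueFn_plantClique`), hence of a member.
* Union bound at each rung (landed `NegLimitedDoor.stub_flipProbLeSum`), summed over `j ≤ T`, list/finite
  sums swapped (`NegLimitedDoor.list_sum_map_finset_sum`, `sum_map_le_length_mul`).
* Lower bound per rung: `p_j ≤ T p⁻ ≤ m^a p⁻ = m^{-2/(k-1)}` (Bernoulli), so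
  `C(m,k) p_j^{C(k,2)} ≤ m^k/k! · m^{-k} ≤ 1/4` and `SubcriticalNullMass` gives
  `plantFlipProb(p_j, CLIQUE) = Pr[no k-clique] ≥ 1/2` (`plantFlipProb_cliqueFn`).
* Upper bound per member: constants never flip (`plantFlipProb_of_const`); for a monotone member
  `LadderAdvantage` (with `LargeN k δ 1 η m` from `LargeNPow`) gives `Σ_j ≤ (T+1)(η + e^{-m^{c'}}) + 1`.
* Numerics: `(T+1)/2 ≤ (2^{t+1} - 1)((T+1)(η + e^{-m^{c'}}) + 1) ≤ 2 m^{1/k⁴} · 3 (T+1) η`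
  (`2^t ≤ m^{1/k⁴}` from `k⁴ t ≤ ⌊log₂ m⌋`; `e^{-m^{c'}} ≤ η`; `1 ≤ (T+1) η`), i.e.
  `1/2 ≤ 6 m^{1/k⁴ - a}` — false eventually since `a - 1/k⁴ = (k+1)/(k⁴(k-1)) > 0`.
-/

set_option linter.dupNamespace false -- `Summit.PneNP.PneNP.…`: summit = sub-problem name (D-0017 single-conjunct layout)

namespace Summit.PneNP.PneNP.Theorems.NegLimitedLadder

open Finset Filter
open Literature.Computability.Complexity
open Summit.PneNP.PneNP.Theorems.NegLimitedDoor

/-! ### The engine statement (verbatim from the registered skeleton `density-ladder`)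

The three supports `LargeNPow`, `LadderAdvantage`, `SubcriticalNullMass` are the LANDED stubs 1–3 of the
line (`NegLimitedLadderLargeNPow.lean`, `NegLimitedLadderAdvantage.lean`, `NegLimitedLadderNullMass.lean`,
same namespace). -/

/-- target `NeglimitedCliqueFixedK` (verbatim; R9-A, the engine-level theorem of the line): for every fixed
`k ≥ 5`, eventually in `m`, a De Morgan circuit computing `CLIQUE(m,k)` with at most `⌊log₂ m⌋ / k⁴` NOT
gates has more than `m^{k/4} - 1` gates. -/
def NeglimitedCliqueFixedK : Prop :=
  ∀ k : ℕ, 5 ≤ k → ∀ᶠ m : ℕ in atTop,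
    ∀ D : Literature.Computability.Complexity.Circuit ↥(⊤ : SimpleGraph (Fin m)).edgeSet,
      D.IsOver deMorganBasis → D.Computes (cliqueFn m k) → D.negationCount ≤ Nat.log 2 m / k ^ 4 →
      (m : ℝ) ^ ((k : ℝ) / 4) < (D.size : ℝ) + 1

/-! ### Parameter arithmetic at `δ = k⁻³`, `a = 2/(k³(k-1))` -/

/-- The window exponent `a = 2/(k³(k-1))` is admissible: `0 < a < min (slack/2) (1/8)` and `a > 1/k⁴`
(`k ≥ 5`, `δ = k⁻³`). -/
theorem ladder_params {k : ℕ} (hk : 5 ≤ k) :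
    0 < 2 / ((k : ℝ) ^ 3 * ((k : ℝ) - 1)) ∧
    2 / ((k : ℝ) ^ 3 * ((k : ℝ) - 1)) < slack k (1 / (k : ℝ) ^ 3) / 2 ∧
    2 / ((k : ℝ) ^ 3 * ((k : ℝ) - 1)) < 1 / 8 ∧
    1 / (k : ℝ) ^ 4 < 2 / ((k : ℝ) ^ 3 * ((k : ℝ) - 1)) := by
  have hK : (5 : ℝ) ≤ k := by exact_mod_cast hk
  set K : ℝ := (k : ℝ) with hKdef
  have hK1 : (4 : ℝ) ≤ K - 1 := by linarith
  have hK0 : (0 : ℝ) < K := by linarith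
  have hK3 : (125 : ℝ) ≤ K ^ 3 := by
    have h := pow_le_pow_left₀ (by norm_num : (0 : ℝ) ≤ 5) hK 3
    norm_num at h
    exact h
  have hden : (500 : ℝ) ≤ K ^ 3 * (K - 1) := by nlinarith
  have hden0 : (0 : ℝ) < K ^ 3 * (K - 1) := by linarith
  refine ⟨by positivity, ?_, ?_, ?_⟩
  · unfold slack
    rw [lt_div_iff₀ two_pos, lt_min_iff]
    constructor
    · rw [div_mul_eq_mul_div, div_lt_iff₀ hden0]
      have e : (1 - 1 / K ^ 3 * (K - 2)) * (K ^ 3 * (K - 1)) = (K ^ 3 - (K - 2)) * (K - 1) := by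
        field_simp
      rw [e]
      nlinarith
    · rw [div_mul_eq_mul_div, div_lt_iff₀ hden0]
      have e : (2 / (K - 1) - 1 / K ^ 3 * K) * (K ^ 3 * (K - 1)) = 2 * K ^ 3 - K * (K - 1) := by
        field_simp
      rw [e]
      nlinarith
  · rw [div_lt_div_iff₀ hden0 (by norm_num)]
    nlinarith
  · rw [div_lt_div_iff₀ (by positivity) hden0]
    nlinarith

/-- The exponent identity `a - 2(1+δ)/(k-1) = -2/(k-1)` (`δ = k⁻³`, `a = 2/(k³(k-1))`): the top rung
`m^a · p⁻` is the threshold density `m^{-2/(k-1)}`. -/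
theorem ladder_exponent {k : ℕ} (hk : 5 ≤ k) :
    2 / ((k : ℝ) ^ 3 * ((k : ℝ) - 1)) + -(2 * (1 + 1 / (k : ℝ) ^ 3)) / ((k : ℝ) - 1) =
      -(2 / ((k : ℝ) - 1)) := by
  have hK : (5 : ℝ) ≤ k := by exact_mod_cast hk
  have hK1 : ((k : ℝ) - 1) ≠ 0 := by linarith
  have hK0 : (k : ℝ) ≠ 0 := by linarith
  field_simp
  ring

/-! ### Small arithmetic lemmas -/

/-- NOT budget: `t ≤ ⌊log₂ m⌋ / k⁴` gives `2^t ≤ m^{1/k⁴}` (`m ≥ 1`, `k ≥ 1`). -/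
theorem two_pow_le_rpow_of_budget {m k t : ℕ} (hm : 1 ≤ m) (hk : 1 ≤ k)
    (ht : t ≤ Nat.log 2 m / k ^ 4) : (2 : ℝ) ^ t ≤ (m : ℝ) ^ (1 / (k : ℝ) ^ 4) := by
  have hk4 : 0 < k ^ 4 := by positivity
  have h1 : k ^ 4 * t ≤ Nat.log 2 m := by
    have := (Nat.le_div_iff_mul_le hk4).1 ht
    linarith [Nat.mul_comm t (k ^ 4)]
  have h2 : 2 ^ (k ^ 4 * t) ≤ m :=
    (Nat.pow_le_pow_right (by norm_num) h1).trans (Nat.pow_log_le_self 2 (by omega))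
  have h3 : ((2 : ℝ) ^ t) ^ (k ^ 4) ≤ (m : ℝ) := by
    rw [← pow_mul, mul_comm]
    exact_mod_cast h2
  have h4 : (0 : ℝ) ≤ (2 : ℝ) ^ t := by positivity
  have hk4' : (k ^ 4 : ℕ) ≠ 0 := hk4.ne'
  calc (2 : ℝ) ^ t = (((2 : ℝ) ^ t) ^ (k ^ 4)) ^ (((k ^ 4 : ℕ) : ℝ)⁻¹) :=
        (Real.pow_rpow_inv_natCast h4 hk4').symm
    _ ≤ (m : ℝ) ^ (((k ^ 4 : ℕ) : ℝ)⁻¹) :=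
        Real.rpow_le_rpow (by positivity) h3 (by positivity)
    _ = (m : ℝ) ^ (1 / (k : ℝ) ^ 4) := by push_cast; rw [one_div]

/-- Bernoulli along the ladder: `0 ≤ 1 - (1-p)^j ≤ T p` for `j ≤ T`, `p ∈ [0,1]`. -/
theorem ladder_density_bounds {p : ℝ} (hp0 : 0 ≤ p) (hp1 : p ≤ 1) {j T : ℕ} (hjT : j ≤ T) :
    0 ≤ 1 - (1 - p) ^ j ∧ 1 - (1 - p) ^ j ≤ (T : ℝ) * p ∧ 1 - (1 - p) ^ j ≤ 1 := by
  have h1p0 : 0 ≤ 1 - p := by linarith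
  have h1p1 : 1 - p ≤ 1 := by linarith
  refine ⟨?_, ?_, ?_⟩
  · have := pow_le_one₀ h1p0 h1p1 (n := j)
    linarith
  · have hmono : (1 - p) ^ T ≤ (1 - p) ^ j := pow_le_pow_of_le_one h1p0 h1p1 hjT
    have hbern : 1 + (T : ℝ) * (-p) ≤ (1 + (-p)) ^ T := one_add_mul_le_pow (by linarith) T
    rw [← sub_eq_add_neg] at hbern
    linarith
  · have := pow_nonneg h1p0 j
    linarith

/-- First moment below the threshold: for `k ≤ m`, `5 ≤ k` and `0 ≤ q ≤ m^{-2/(k-1)}`,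
`C(m,k) q^{C(k,2)} ≤ 1/4` (indeed `≤ 1/k!`, as `C(m,k) ≤ m^k/k!` and `(m^{-2/(k-1)})^{C(k,2)} = m^{-k}`). -/
theorem firstMoment_le_quarter {m k : ℕ} (hk : 5 ≤ k) (hm : 1 ≤ m) {q : ℝ} (hq0 : 0 ≤ q)
    (hq : q ≤ (m : ℝ) ^ (-(2 / ((k : ℝ) - 1)))) :
    ((m.choose k : ℕ) : ℝ) * q ^ k.choose 2 ≤ 1 / 4 := by
  have hm0 : (0 : ℝ) < m := by exact_mod_cast hm
  have hK : (5 : ℝ) ≤ k := by exact_mod_cast hk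
  have hK1 : ((k : ℝ) - 1) ≠ 0 := by linarith
  -- `C(m,k) ≤ m^k / k!`
  have hC : ((m.choose k : ℕ) : ℝ) ≤ (m : ℝ) ^ k / (k.factorial : ℝ) := by
    have h := Nat.choose_le_pow_div (α := ℝ) k m
    exact_mod_cast h
  -- `q^{C(k,2)} ≤ m^{-k}`
  have hqpow : q ^ k.choose 2 ≤ ((m : ℝ) ^ k)⁻¹ := by
    have h1 : q ^ k.choose 2 ≤ ((m : ℝ) ^ (-(2 / ((k : ℝ) - 1)))) ^ k.choose 2 :=
      pow_le_pow_left₀ hq0 hq _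
    have h2 : ((m : ℝ) ^ (-(2 / ((k : ℝ) - 1)))) ^ k.choose 2 = ((m : ℝ) ^ k)⁻¹ := by
      rw [← Real.rpow_mul_natCast hm0.le, Nat.cast_choose_two]
      have he : -(2 / ((k : ℝ) - 1)) * ((k : ℝ) * ((k : ℝ) - 1) / 2) = -((k : ℕ) : ℝ) := by
        field_simp
      rw [he, Real.rpow_neg hm0.le, Real.rpow_natCast]
    rw [h2] at h1
    exact h1
  -- `k! ≥ 120 ≥ 4`
  have hfact : (4 : ℝ) ≤ (k.factorial : ℝ) := by
    have h5 : (5 : ℕ).factorial ≤ k.factorial := Nat.factorial_le hk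
    have : (120 : ℝ) ≤ (k.factorial : ℝ) := by exact_mod_cast h5
    linarith
  have hmk : (0 : ℝ) < (m : ℝ) ^ k := by positivity
  have hf0 : (0 : ℝ) < (k.factorial : ℝ) := by positivity
  calc ((m.choose k : ℕ) : ℝ) * q ^ k.choose 2
      ≤ ((m : ℝ) ^ k / (k.factorial : ℝ)) * ((m : ℝ) ^ k)⁻¹ :=
        mul_le_mul hC hqpow (pow_nonneg hq0 _) (by positivity)
    _ = 1 / (k.factorial : ℝ) := by
        field_simp
    _ ≤ 1 / 4 := one_div_le_one_div_of_le (by norm_num) hfact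

/-- Eventually the stretched exponential error is below the polynomial threshold:
`exp(-m^{c'}) ≤ m^{-a}`. -/
theorem eventually_exp_le_rpow_neg {c a : ℝ} (hc : 0 < c) :
    ∀ᶠ m : ℕ in atTop, Real.exp (-((m : ℝ) ^ c)) ≤ (m : ℝ) ^ (-a) := by
  have h := eventually_poly_mul_exp_le (A := 1) (m := a) (d := c) (c' := c / 2) hc (by linarith)
  filter_upwards [h, eventually_gt_atTop 0] with m hm hm0
  have hmr : (0 : ℝ) < m := by exact_mod_cast hm0
  have hma : 0 < (m : ℝ) ^ a := Real.rpow_pos_of_pos hmr _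
  have hexp1 : Real.exp (-((m : ℝ) ^ (c / 2))) ≤ 1 := by
    rw [Real.exp_le_one_iff]
    have := Real.rpow_nonneg hmr.le (c / 2)
    linarith
  have hle1 : (m : ℝ) ^ a * Real.exp (-((m : ℝ) ^ c)) ≤ 1 := by
    rw [one_mul] at hm
    linarith
  rw [Real.rpow_neg hmr.le, ← one_div, le_div_iff₀ hma, mul_comm]
  exact hle1

/-! ### The stub -/

/-- **Stub 4 of line `density-ladder` PROVED** (`stub_fixedKAssembly`, by name):
`LargeNPow → LadderAdvantage → SubcriticalNullMass → NeglimitedCliqueFixedK`. -/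
theorem stub_fixedKAssembly :
    LargeNPow → LadderAdvantage → SubcriticalNullMass → NeglimitedCliqueFixedK := by
  intro hLNP hLA hSNM k hk
  classical
  -- parameters
  have hK : (5 : ℝ) ≤ k := by exact_mod_cast hk
  have hK0 : (0 : ℝ) < k := by linarith
  set δ : ℝ := 1 / (k : ℝ) ^ 3 with hδ
  set a : ℝ := 2 / ((k : ℝ) ^ 3 * ((k : ℝ) - 1)) with ha
  have hδ0 : 0 < δ := by positivity
  have hδ1 : δ ≤ 1 / (k : ℝ) ^ 3 := le_rfl
  obtain ⟨ha0, haS, ha8, hak⟩ := ladder_params hk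
  have hcp : 0 < cPrime k δ := cPrime_pos hk hδ0 hδ1
  -- eventual conditions in `m`
  have e1 := hLNP k hk δ hδ0 hδ1 1 a ha0 haS ha8
  have e2 := eventually_exp_le_rpow_neg (a := a) hcp
  have e3 := eventually_mul_rpow_neg_lt (c := a - 1 / (k : ℝ) ^ 4) (by linarith)
    (by norm_num : (0 : ℝ) < 1 / 2) 6
  filter_upwards [e1, e2, e3, eventually_ge_atTop 1] with m hLarge hexp hsmall hm1
  intro D hD hcomp hneg
  by_contra hcon
  rw [not_lt] at hcon
  -- notation
  set t : ℕ := Nat.log 2 m / k ^ 4 with ht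
  set p : ℝ := pMinus k δ m with hp
  set η : ℝ := (m : ℝ) ^ (-a) with hη
  set ε : ℝ := Real.exp (-((m : ℝ) ^ cPrime k δ)) with hε
  set T : ℕ := ⌊(m : ℝ) ^ a⌋₊ with hT
  set q : ℕ → ℝ := fun j => 1 - (1 - p) ^ j with hq
  have hm0 : (0 : ℝ) < m := by exact_mod_cast hm1
  have hη0 : 0 < η := Real.rpow_pos_of_pos hm0 _
  have hε0 : 0 < ε := Real.exp_pos _
  have hkm : k ≤ m := hLarge.hkn
  have hp0 : 0 ≤ p := Real.rpow_nonneg hm0.le _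
  have hp1 : p ≤ 1 := by have := hLarge.hp; linarith
  have hma0 : 0 ≤ (m : ℝ) ^ a := Real.rpow_nonneg hm0.le _
  have hTle : (T : ℝ) ≤ (m : ℝ) ^ a := Nat.floor_le hma0
  have hTlt : (m : ℝ) ^ a < (T : ℝ) + 1 := Nat.lt_floor_add_one _
  -- the top rung is the threshold density
  have htop : (T : ℝ) * p ≤ (m : ℝ) ^ (-(2 / ((k : ℝ) - 1))) := by
    calc (T : ℝ) * p ≤ (m : ℝ) ^ a * p := mul_le_mul_of_nonneg_right hTle hp0
      _ = (m : ℝ) ^ (-(2 / ((k : ℝ) - 1))) := by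
          rw [hp, pMinus, ← Real.rpow_add hm0, ← ladder_exponent hk]
  have hqb : ∀ j, j ≤ T → 0 ≤ q j ∧ q j ≤ (m : ℝ) ^ (-(2 / ((k : ℝ) - 1))) ∧ q j ≤ 1 := by
    intro j hj
    obtain ⟨h0, hTp, h1⟩ := ladder_density_bounds hp0 hp1 hj
    exact ⟨h0, hTp.trans htop, h1⟩
  -- the Amano–Maruoka / Rossman cover of `D`
  obtain ⟨gs, hlen, hmem, hcov⟩ := stub_amCoverMonPairs _ D t hD hneg
  -- planted flips of CLIQUE are jumps of `D`, hence of a member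
  have hcover : ∀ A ∈ powersetCard k (univ : Finset (Fin m)), ∀ x,
      cliqueFn m k x ≠ cliqueFn m k (plantClique A x) →
        ∃ g ∈ gs, g x ≠ g (plantClique A x) := by
    intro A hA x hx
    have hAk : #A = k := (mem_powersetCard.1 hA).2
    have htrue : cliqueFn m k (plantClique A x) = true := cliqueFn_plantClique (by omega) x
    have hfalse : cliqueFn m k x = false := by
      cases h : cliqueFn m k x
      · rfl
      · rw [h, htrue] at hx
        exact absurd rfl hx
    obtain ⟨g, hg, hgx, hgy⟩ := hcov x (plantClique A x) (le_plantClique A x)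
      (by rw [hcomp x, hfalse]) (by rw [hcomp, htrue])
    exact ⟨g, hg, by rw [hgx, hgy]; decide⟩
  -- (1) lower bound at each rung: the clique-free mass is at least `1/2`
  have hlow : ∀ j ∈ range (T + 1), (1 / 2 : ℝ) ≤ plantFlipProb m k (q j) (cliqueFn m k) := by
    intro j hj
    have hjT : j ≤ T := by have := mem_range.1 hj; omega
    obtain ⟨hq0, hqt, hq1⟩ := hqb j hjT
    have hfm := firstMoment_le_quarter hk hm1 hq0 hqt
    have h := hSNM m k (q j) (1 / 4) hkm hq0 hq1 hfm (by norm_num)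
    rw [plantFlipProb_cliqueFn hkm]
    have e : (1 : ℝ) - 2 * (1 / 4) = 1 / 2 := by norm_num
    rw [e] at h
    exact h
  -- (2) upper bound per member
  set B : ℝ := ((T : ℝ) + 1) * (η + ε) + 1 with hB
  have hB0 : 0 ≤ B := by positivity
  have hup : ∀ g ∈ gs, ∑ j ∈ range (T + 1), plantFlipProb m k (q j) g ≤ B := by
    intro g hg
    rcases hmem g hg with ⟨b, hb⟩ | ⟨M, hM, hMsize, hMg⟩
    · rw [sum_eq_zero fun j _ => plantFlipProb_of_const (q j) hb]
      exact hB0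
    · have hM01 : M.IsOver monotoneBasis01 := hM.mono monotoneBasis_subset_monotoneBasis01
      have hMsz : (M.size : ℝ) + 1 ≤ (m : ℝ) ^ ((k : ℝ) / 4) := by
        have : (M.size : ℝ) ≤ D.size := by exact_mod_cast hMsize
        linarith
      have h := hLA m k hk δ hδ0 hδ1 η hη0 hLarge M hM01 hMsz T
      calc ∑ j ∈ range (T + 1), plantFlipProb m k (q j) g
          = ∑ j ∈ range (T + 1), plantFlipProb m k (1 - (1 - pMinus k δ m) ^ j) M.eval :=
            sum_congr rfl fun j _ => by rw [plantFlipProb_congr hMg]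
        _ ≤ B := h
  -- (3) the union bound, summed over the rungs
  have hchain : ((T : ℝ) + 1) * (1 / 2) ≤ (gs.length : ℝ) * B := by
    calc ((T : ℝ) + 1) * (1 / 2) = ∑ j ∈ range (T + 1), (1 / 2 : ℝ) := by
          rw [sum_const, card_range, nsmul_eq_mul]
          push_cast
          ring
      _ ≤ ∑ j ∈ range (T + 1), plantFlipProb m k (q j) (cliqueFn m k) := sum_le_sum hlow
      _ ≤ ∑ j ∈ range (T + 1), (gs.map (plantFlipProb m k (q j))).sum :=
          sum_le_sum fun j hj => by
            have hjT : j ≤ T := by have := mem_range.1 hj; omega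
            obtain ⟨hq0, -, hq1⟩ := hqb j hjT
            exact stub_flipProbLeSum m k (q j) hq0 hq1 _ gs hcover
      _ = (gs.map fun g => ∑ j ∈ range (T + 1), plantFlipProb m k (q j) g).sum :=
          (list_sum_map_finset_sum gs _ _).symm
      _ ≤ (gs.length : ℝ) * B := sum_map_le_length_mul gs _ B hup
  -- (4) numerics
  have hlenR : (gs.length : ℝ) ≤ 2 * (m : ℝ) ^ (1 / (k : ℝ) ^ 4) := by
    have h2t : (2 : ℝ) ^ t ≤ (m : ℝ) ^ (1 / (k : ℝ) ^ 4) :=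
      two_pow_le_rpow_of_budget hm1 (by omega) le_rfl
    have h1 : 1 ≤ 2 ^ (t + 1) := Nat.one_le_two_pow
    have h2 : gs.length + 1 ≤ 2 ^ (t + 1) := by omega
    have h3 : ((gs.length + 1 : ℕ) : ℝ) ≤ ((2 ^ (t + 1) : ℕ) : ℝ) := by exact_mod_cast h2
    push_cast at h3
    rw [pow_succ] at h3
    linarith
  have hBle : B ≤ ((T : ℝ) + 1) * (3 * η) := by
    have h1 : 1 ≤ ((T : ℝ) + 1) * η := by
      have hid : (m : ℝ) ^ a * η = 1 := by
        rw [hη, ← Real.rpow_add hm0, add_neg_cancel, Real.rpow_zero]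
      nlinarith
    have h2 : ε ≤ η := hexp
    have hT0 : (0 : ℝ) ≤ (T : ℝ) + 1 := by positivity
    nlinarith
  have hfin : (1 / 2 : ℝ) ≤ 6 * (m : ℝ) ^ (-(a - 1 / (k : ℝ) ^ 4)) := by
    have hT0 : (0 : ℝ) < (T : ℝ) + 1 := by positivity
    have h := calc ((T : ℝ) + 1) * (1 / 2) ≤ (gs.length : ℝ) * B := hchain
      _ ≤ (2 * (m : ℝ) ^ (1 / (k : ℝ) ^ 4)) * (((T : ℝ) + 1) * (3 * η)) :=
          mul_le_mul hlenR hBle hB0 (by positivity)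
      _ = ((T : ℝ) + 1) * (6 * ((m : ℝ) ^ (1 / (k : ℝ) ^ 4) * η)) := by ring
    have h2 := le_of_mul_le_mul_left h hT0
    rw [hη, ← Real.rpow_add hm0] at h2
    have he : 1 / (k : ℝ) ^ 4 + -a = -(a - 1 / (k : ℝ) ^ 4) := by ring
    rw [he] at h2
    exact h2
  linarith

/-- **R9-A `NeglimitedCliqueFixedK` PROVED outright**: for every fixed `k ≥ 5`, eventually in `m`, every
De Morgan circuit computing `CLIQUE(m,k)` with at most `⌊log₂ m⌋ / k⁴` NOT gates has more than
`m^{k/4} - 1` gates — the assembly applied to the three landed stubs. -/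
theorem neglimitedCliqueFixedK_holds : NeglimitedCliqueFixedK :=
  stub_fixedKAssembly stub_largeNPow stub_ladderAdvantage stub_subcriticalNullMass

end Summit.PneNP.PneNP.Theorems.NegLimitedLadder
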